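import Literature.NumberTheory.EllipticCurves.TateModuleFreeProofs
import HarnessLib

/-!
# Finiteness of the rational Tate module `V_p E` (Silverman, *AEC*, III.7.1): discharge

D-0014 keeps `Literature/` sorry-free by stating cited results as named facts `def X : Prop`.
This sibling proof file of `Literature.NumberTheory.EllipticCurves.TateModule` discharges,
unconditionally and for *every* prime `p` (including `p = char F`), the named fact

* `WeierstrassCurve.module_finite_rationalTateModule W p` (`dim_{ℚ_p} V_p E < ∞`),

i.e. the qualitative content, after `⊗ ℚ_p` (Remark III.7.2), of Silverman, *AEC*, Prop. III.7.1
((a) `T_ℓ E ≅ ℤ_ℓ × ℤ_ℓ` for `ℓ ≠ char K`; (b) `T_p E ≅ {0}` or `ℤ_p` for `p = char K > 0`), whose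
printed proof is "This follows immediately from (III.6.4b,c)" (III.§7, pp. 87–88).

## The chain of reductions (all in the tree, assembled here)

1. `WeierstrassCurve.finite_torsionBy_baseChange` (file `DivisionPolynomialTorsion`, elementary
   and characteristic-free): `E(L)[n]` is finite for `n ≠ 0` (Silverman, *AEC*, Cor. III.6.4);
   at `L = F̄` this is `WeierstrassCurve.finite_torsionPoints_algebraicClosure`
   (file `TateModuleFreeProofs`).
2. `Literature.NumberTheory.EllipticCurves.TateModule.finite_of_finite_torsionBy`, `free_of_finite_torsionBy` (file `TateModuleFree`,
   any abelian group `A`: if `A[p]` is finite then `T_p A` is finitely generated — Nakayama for the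
   `p`-adically complete `ℤ_p` and the separated `T_p A` with `T_p A / p ↪ A[p]` — and free, being
   torsion-free over a PID); for `A = E(F̄)` these are `module_finite_tateModule_holds`,
   `module_free_tateModule_holds` (file `TateModuleFreeProofs`).
3. (This file.) Base change: `V_p A = ℚ_p ⊗_{ℤ_p} T_p A` is finite over `ℚ_p` when `T_p A` is
   finite over `ℤ_p` (`Literature.NumberTheory.EllipticCurves.RationalTateModule.finite_of_finite_torsionBy`), and
   `dim_{ℚ_p} V_p A = rank_{ℤ_p} T_p A` (`finrank_eq_of_finite_torsionBy`, Mathlib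
   `Module.finrank_baseChange`): `module_finite_rationalTateModule_holds`,
   `finrank_rationalTateModule_eq_finrank_tateModule`.

The exact ranks (`2` for `p ≠ char F`: the named facts `finrank_tateModule_eq_two`,
`finrank_rationalTateModule_eq_two`) need the point count `#E[p^k] = p^{2k}` (III.6.4(b)) and are
not asserted here (see `TateModuleProofs`, `TateModuleRank`, `TwoPowerTorsion` for `p = 2`).

## References

* J. H. Silverman, *The Arithmetic of Elliptic Curves*, 2nd ed., GTM 106, Springer 2009:
  III.§7 "The Tate Module" (pp. 87–91 of the printed text): Prop. III.7.1 and Remark III.7.2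
  (pp. 87–88; held PDF p. 83); III.§6 "The Dual Isogeny" (pp. 80–86): Cor. III.6.4 (held PDF
  pp. 81–82). [SilvermanAEC2009]
* J.-P. Serre, *Abelian ℓ-adic representations and elliptic curves* (1968), I.1.1–1.2
  (`T_ℓ`, `V_ℓ = ℚ_ℓ ⊗ T_ℓ`).

## Design

`noncomputable section`, `open scoped Classical` (the group law on `geomPoints W` and the named
facts are stated with the classical `DecidableEq` instances, as in `GaloisAction`, `TateModule`,
`TateModuleFree`); one universe `u`; deliberate dot-notation extensions in
`namespace WeierstrassCurve`, generic material in `namespace Literature.RationalTateModule`.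
This file only adds theorems (no new definitions).
-/

noncomputable section

open scoped Classical
open scoped AddSubgroup TensorProduct

universe u

namespace Literature.NumberTheory.EllipticCurves

namespace RationalTateModule

variable {A : Type u} [AddCommGroup A] {p : ℕ} [Fact p.Prime]

/-- If `A[p]` is finite then `V_p A = ℚ_p ⊗_{ℤ_p} T_p A` is a finite-dimensional `ℚ_p`-vector
space (`T_p A` is finitely generated, `TateModule.finite_of_finite_torsionBy`, and finiteness is
stable under base change). Silverman, *AEC*, Prop. III.7.1 with Remark III.7.2; Serre (1968),
I.1.2. [cite: SilvermanAEC2009, Prop. III.7.1 and Remark III.7.2] -/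
theorem finite_of_finite_torsionBy (hfin : Finite (A[(p : ℕ)])) :
    Module.Finite ℚ_[p] (RationalTateModule A p) := by
  haveI := TateModule.finite_of_finite_torsionBy hfin
  change Module.Finite ℚ_[p] (ℚ_[p] ⊗[ℤ_[p]] TateModule A p)
  infer_instance

/-- If `A[p]` is finite then `dim_{ℚ_p} V_p A = rank_{ℤ_p} T_p A` (`T_p A` is free of finite rank,
`TateModule.free_of_finite_torsionBy`, and Mathlib's `Module.finrank_baseChange`).
Silverman, *AEC*, Remark III.7.2; Serre (1968), I.1.2. [folklore] -/
theorem finrank_eq_of_finite_torsionBy (hfin : Finite (A[(p : ℕ)])) :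
    Module.finrank ℚ_[p] (RationalTateModule A p) = Module.finrank ℤ_[p] (TateModule A p) := by
  haveI := TateModule.free_of_finite_torsionBy hfin
  haveI := TateModule.finite_of_finite_torsionBy hfin
  change Module.finrank ℚ_[p] (ℚ_[p] ⊗[ℤ_[p]] TateModule A p) = _
  rw [Module.finrank_baseChange]

end RationalTateModule

end Literature.NumberTheory.EllipticCurves

namespace WeierstrassCurve

open Literature.NumberTheory.EllipticCurves

variable {F : Type u} [Field F] (W : WeierstrassCurve F) (p : ℕ) [Fact p.Prime]

/-- The geometric `p`-torsion `E(F̄)[p]` of an elliptic curve is finite for every prime `p`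
(the input of the Tate-module finiteness theorems): the case `n = p`, `L = F̄` of Silverman,
*AEC*, Cor. III.6.4, from `finite_torsionPoints_algebraicClosure` (file `TateModuleFreeProofs`,
itself `finite_torsionBy_baseChange` of `DivisionPolynomialTorsion`).
[cite: SilvermanAEC2009, Cor. III.6.4] -/
theorem finite_geomTorsion_prime [W.IsElliptic] : Finite ((geomPoints W)[(p : ℕ)]) :=
  finite_torsionPoints_algebraicClosure W (by exact_mod_cast (Fact.out : p.Prime).ne_zero)

/-- **Discharge of `WeierstrassCurve.module_finite_rationalTateModule`**: for an elliptic curve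
`W` over any field `F` and every prime `p`, the rational Tate module `V_p E = ℚ_p ⊗_{ℤ_p} T_p E`
is a finite-dimensional `ℚ_p`-vector space. Silverman, *AEC*, Prop. III.7.1 with Remark III.7.2
(`T_p E` has finite rank over `ℤ_p` for every `p`, and `V_p = T_p ⊗ ℚ_p`); here from finiteness
of `E(F̄)[p]` (Cor. III.6.4, `finite_geomTorsion_prime`) through
`RationalTateModule.finite_of_finite_torsionBy`.
[cite: SilvermanAEC2009, Prop. III.7.1 and Remark III.7.2 (III.§7, pp. 87–88)] -/
theorem module_finite_rationalTateModule_holds : module_finite_rationalTateModule W p := by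
  intro _
  exact RationalTateModule.finite_of_finite_torsionBy (W.finite_geomTorsion_prime p)

/-- For an elliptic curve over any field and every prime `p`,
`dim_{ℚ_p} V_p E = rank_{ℤ_p} T_p E` (so the named facts `finrank_rationalTateModule_eq_two` and
`finrank_tateModule_eq_two` are equivalent). Silverman, *AEC*, Remark III.7.2. [folklore] -/
theorem finrank_rationalTateModule_eq_finrank_tateModule [W.IsElliptic] :
    Module.finrank ℚ_[p] (W.rationalTateModule p) = Module.finrank ℤ_[p] (W.tateModule p) :=
  RationalTateModule.finrank_eq_of_finite_torsionBy (W.finite_geomTorsion_prime p)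

/-- `V_p E` is finite-dimensional over `ℚ_p` (instance form of
`module_finite_rationalTateModule_holds`, for files that want typeclass inference).
Silverman, *AEC*, Prop. III.7.1 with Remark III.7.2.
[cite: SilvermanAEC2009, Prop. III.7.1 and Remark III.7.2] -/
theorem finite_rationalTateModule [W.IsElliptic] :
    Module.Finite ℚ_[p] (W.rationalTateModule p) :=
  module_finite_rationalTateModule_holds W p

end WeierstrassCurve
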